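import Literature.AlgebraicGeometry.Resolution.RegularCentreLocalCodim
import Literature.AlgebraicGeometry.Resolution.RegularQuotientIdeal
import Literature.AlgebraicGeometry.Resolution.SmoothImpliesRegular
import Literature.AlgebraicGeometry.Resolution.AlterationsSectionDivisor
import Literature.AlgebraicGeometry.Resolution.MarkedIdeals
import HarnessLib

/-!
# [OURS · L1 W4.5(b) · EL♮(3)] T-DIRLIFT adapter — EVERY 2-FRAME OF A CODIMENSION-2 REGULAR CENTRE IS QUASI-REGULAR

Crux chain w45b (cell `res-hironaka`, slot W4.5(b)), working crux **EL♮** = stmt-ResolutionOfSingularities-20038, child **EL♮(3)** =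
stmt-ResolutionOfSingularities-20148, route EquisingularLift, line `sections`. A dischargeable form of the hypothesis `IsQuasiRegular c`
of the T-DIRLIFT bricks (D3b `exists_subschemeIso_directionCentre` p555056, B0 `exists_frame_stalkIdeal_directionCentre_eq_of_section`
p556107, `directionRoundStep`): at a point of a regular scheme where the in-carrier curve is regular of codimension `2`, ANY pair of
generators of its stalk ideal is quasi-regular. HONEST FRAMING: OURS; NOT a statement of any manuscript; AI-written, weaker than expert
review. No `sorry`; standard axioms. DEF-FREE. `--supports stmt-ResolutionOfSingularities-20148 --as helper`.

* `isQuasiRegular_of_span_pair_eq_of_codim_two` — `R` regular local, `J ⊆ 𝔪` with `R ⧸ J` regular local and `dim R/J + 2 = dim R`,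
  `J = (c 0, c 1)` ⇒ `IsQuasiRegular c`. Proof: the tree's `exists_span_eq_of_isRegularLocalRing_quotient` selects from `{c 0, c 1}` a
  sub-family with independent differentials generating `J`; by Matsumura 14.2 (`RegularParameters.isRegularLocalRing_quotient_span_range`)
  it has exactly `2` members, so it IS `c` up to order; conclude by `isQuasiRegular_of_linearIndependent_toCotangent` (Rees, Matsumura 16.2).
* `isQuasiRegular_of_span_pair_eq_stalkIdeal` (rev 2, append-only) — the scheme form at a point of a regular `V(I) ⊆ X`
  (`stalkIdeal_ker_eq_ker_stalkMap` + `ker_subschemeι`: `𝒪_{V(I),s} ≅ 𝒪_{X,x} ⧸ I_x`).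

References: Matsumura, Thms. 14.2, 16.2 [Matsumura1987] — through the tree (`RegularQuotientIdeal`, `RegularParameterQuotient`,
`RegularCentreLocalCodim`, `SmoothImpliesRegular`).
-/

set_option linter.dupNamespace false -- mandated namespace `Summit.<Summit>.<Problem>` of this single-conjunct summit

noncomputable section

open CategoryTheory AlgebraicGeometry IsLocalRing
open Literature.AlgebraicGeometry.Resolution
open AlgebraicGeometry.Scheme.IdealSheafData

namespace Summit.ResolutionOfSingularities.ResolutionOfSingularities.Cruxes.EquisingularLiftNat.Sections

universe u

/-- **Every pair of generators of the ideal of a codimension-`2` regular centre in a regular local ring is quasi-regular.**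
[cite: Matsumura1987, Thm. 14.2 with Thm. 16.2] -/
theorem isQuasiRegular_of_span_pair_eq_of_codim_two {R : Type u} [CommRing R] [IsRegularLocalRing R] {J : Ideal R}
    (hJ : J ≤ maximalIdeal R) [IsRegularLocalRing (R ⧸ J)]
    (hcodim : ringKrullDim (R ⧸ J) + 2 = ringKrullDim R)
    (c : Fin 2 → R) (hc : Ideal.span (Set.range c) = J) : IsQuasiRegular c := by
  classical
  obtain ⟨n, f, hfG, hspan, hli⟩ := exists_span_eq_of_isRegularLocalRing_quotient hJ (Set.range c) hc
  have hf𝔪 : ∀ i, f i ∈ maximalIdeal R := fun i => hJ (hspan ▸ Ideal.subset_span ⟨i, rfl⟩)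
  have hc𝔪 : ∀ i, c i ∈ maximalIdeal R := fun i => hJ (hc ▸ Ideal.subset_span ⟨i, rfl⟩)
  -- the selected family has exactly `2` members (Matsumura 14.2: `dim R/(f) + n = dim R`)
  have hdim := (RegularParameters.isRegularLocalRing_quotient_span_range f hf𝔪
    (forall_mem_maximalIdeal_of_linearIndependent_toCotangent f hf𝔪 hli)).2
  rw [hspan] at hdim
  have hn : n = 2 := by
    obtain ⟨d, hd⟩ := exists_ringKrullDim_eq_natCast (R ⧸ J)
    have h := hdim.trans hcodim.symm
    rw [hd] at h
    have h' : ((d + n : ℕ) : WithBot ℕ∞) = ((d + 2 : ℕ) : WithBot ℕ∞) := by push_cast; exact h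
    have h'' : d + n = d + 2 := by exact_mod_cast h'
    omega
  subst hn
  -- `f` is injective and takes its values in `{c 0, c 1}`: it is `c` up to a permutation
  have hfinj : Function.Injective f := by
    intro i j hij
    by_contra hne
    have h := hli.injective (by
      show (maximalIdeal R).toCotangent ⟨f i, hf𝔪 i⟩ = (maximalIdeal R).toCotangent ⟨f j, hf𝔪 j⟩
      congr 1
      exact Subtype.ext hij)
    exact hne h
  have hex : ∀ i, ∃ k, c k = f i := fun i => hfG i
  choose a ha using hex
  have hainj : Function.Injective a := fun i j hij => hfinj (by rw [← ha i, ← ha j, hij])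
  let α : Fin 2 ≃ Fin 2 := Equiv.ofBijective a (Finite.injective_iff_bijective.mp hainj)
  have hσ : ∀ k, c k = f (α.symm k) := fun k => by
    have h1 : a (α.symm k) = k := α.apply_symm_apply k
    rw [← ha (α.symm k), h1]
  have hli' : LinearIndependent (ResidueField R) fun i => (maximalIdeal R).toCotangent ⟨c i, hc𝔪 i⟩ := by
    have hfun : (fun i => (maximalIdeal R).toCotangent ⟨c i, hc𝔪 i⟩) =
        (fun i => (maximalIdeal R).toCotangent ⟨f i, hf𝔪 i⟩) ∘ α.symm := by
      funext i
      simp only [Function.comp_apply]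
      congr 1
      exact Subtype.ext (hσ i)
    rw [hfun]
    exact hli.comp _ α.symm.injective
  exact isQuasiRegular_of_linearIndependent_toCotangent c hc𝔪 hli'

/-- **Scheme form: frames of a codimension-`2` regular centre are quasi-regular.** For an ideal sheaf `I` on `X` with `V(I)` a
regular scheme, a point `x = ι s` of `V(I)` at which `𝒪_{X,x}` is regular and `dim (𝒪_{X,x} ⧸ I_x) + 2 = dim 𝒪_{X,x}`, every pair `c`
with `(c 0, c 1) = I_x` is quasi-regular — the `hdir` / `hqr` hypotheses of the T-DIRLIFT bricks at such points (rev 2, append-only).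
[cite: Matsumura1987, Thm. 14.2 with Thm. 16.2] -/
theorem isQuasiRegular_of_span_pair_eq_stalkIdeal {X : Scheme.{u}} (I : X.IdealSheafData) (hI : Scheme.IsRegular I.subscheme)
    (s : I.subscheme) [IsRegularLocalRing (X.presheaf.stalk (I.subschemeι s))]
    (hcodim : ringKrullDim (X.presheaf.stalk (I.subschemeι s) ⧸ stalkIdeal I (I.subschemeι s)) + 2 =
      ringKrullDim (X.presheaf.stalk (I.subschemeι s)))
    (c : Fin 2 → X.presheaf.stalk (I.subschemeι s)) (hc : Ideal.span (Set.range c) = stalkIdeal I (I.subschemeι s)) :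
    IsQuasiRegular c := by
  -- `𝒪_{V(I),s} ≅ 𝒪_{X,x} ⧸ I_x` (closed immersion: surjective stalk map with kernel `I_x`)
  have hsurj : Function.Surjective (I.subschemeι.stalkMap s).hom := I.subschemeι.stalkMap_surjective s
  have hker : RingHom.ker (I.subschemeι.stalkMap s).hom = stalkIdeal I (I.subschemeι s) := by
    rw [← stalkIdeal_ker_eq_ker_stalkMap, Scheme.IdealSheafData.ker_subschemeι]
  haveI := hI s
  haveI : IsRegularLocalRing (X.presheaf.stalk (I.subschemeι s) ⧸ stalkIdeal I (I.subschemeι s)) :=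
    IsRegularLocalRing.of_ringEquiv
      (((RingHom.quotientKerEquivOfSurjective hsurj).symm).trans (Ideal.quotEquivOfEq hker))
  have hx : I.subschemeι s ∈ (I.support : Set X) := by
    rw [← Scheme.IdealSheafData.range_subschemeι]; exact ⟨s, rfl⟩
  exact isQuasiRegular_of_span_pair_eq_of_codim_two ((mem_support_iff_stalkIdeal_le I _).mp hx) hcodim c hc

end Summit.ResolutionOfSingularities.ResolutionOfSingularities.Cruxes.EquisingularLiftNat.Sections

end
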